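import Mathlib
import HarnessLib
import Summits.QuantumFields.YangMills.Theses.LangevinControlUV
import Summits.QuantumFields.YangMills.Theorems.FemtoCurvatureTwoPoint.Negative.PlaquetteFreezing
import Summits.QuantumFields.YangMills.Theorems.FemtoCurvatureTwoPoint.Negative.ForcedDividend
import Summits.QuantumFields.YangMills.Theorems.FemtoCurvatureTwoPoint.Negative.UpperOnly

/-!
# Line `generic-step-gamma-encoding` — skeleton for crux `FemtoCurvatureTwoPoint`
# (stmt-QuantumFields-9363, route LangevinControlUV)

Crux-plan of idea card `Cruxes/FemtoCurvatureTwoPoint/Ideas/generic-step-gamma-encoding.md`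
(ideator 1, triage r1: pass ×3).

**The line.** The crux quantifies `∃ a, ∃ Γ β₀ ℓ₀ c C, …` with the shape `Γ` constrained only
pointwise (`0 < Γ ≤ 1` on `(0, ℓ₀]`). A STEP unit map `a(β) = α_k` on `β ∈ [2^k, 2^{k+1})` with
GENERIC values `α_k` makes every argument `s = dist · a(β)` at which the crux evaluates `Γ`
(`dist = √m`, `m ≥ 1`) come from exactly one step `k`, so `Γ(√m · α_k) := 4^{-k}` (else `1`) is a
legitimate shape, and `2^k ≤ β < 2^{k+1}` turns two-sided FIXED-TORUS bounds `[c, C] · β⁻²` into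
`[(c/4) Γ, |C| Γ]`. The values `α_k := (1 + t 2^{-k}) / (L_k + 1)` (generic `t ∈ [1/2, 1]`) are tied
to a threshold ladder `L_k := max {L : T(L) ≤ 2^k}` (`T` a monotone envelope of the per-torus
thresholds), so that a femto torus `L · a(β) ≤ 1` in step `k` is exactly a VALIDATED torus
`L ≤ L_k`, and `a → 0` because `L_k → ∞`. Hence the crux AS TYPED follows from
`FixedTorusTwoSided` (= the card's C⁺ `FixedTorusSemiclassicalTwoPoint`, in the sharpened threshold
form asked for by TRIAGE r1-1 (A)/(B) and r1-3): on EVERY torus `(ℤ/L)⁴`, for `β ≥ B(L)` (an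
arbitrary, `L`-dependent threshold), `c ≤ β² n⁸ Cov(P_0^{01}, P_{ne₂}^{01}) ≤ C` for `8 ≤ 8n ≤ L` and
`β² |Cov(P_x^{ij}, P_y^{i'j'})| dist⁸ ≤ C` for `x ≠ y`, with `c, C` uniform in `L`. This transfer
(`encoding`, the card's `crux_of_encoding`) is PROVED below, sorry-free; it is the composition.

**Stubs (registered; the only `sorry`s in this file; statements = `Sig.stub_<name>`).**
* `stub_kernelMargin : Sig.stub_kernelMargin` (`= KernelMargin`) — K1 of the card: the zero-mode-removed periodic lattice
  field-strength kernel `K_L(x) = L⁻⁴ Σ_{k ≠ 0} (k̂₀² + k̂₁²)/k̂² cos(k·x)` obeys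
  `c_K ≤ n⁸ K_L(ne₂)² ≤ C_K` for `8n ≤ L` and `K_L(x)² dist(0,x)⁸ ≤ C_K` for `x ≠ 0`, uniformly in
  `L` (provable now: lattice Fourier analysis; numerics j006894 / kernel_check / slice_psd_tables:
  `n⁸K² ∈ [0.0047, 0.034]`, all-pairs sup `(5.01/π²)²`).
* `stub_axisLower : Sig.stub_axisLower` (`= KernelMargin → AxisLowerFixedTorus`) — K2⁻, the HARDEST and the unique
  load-bearing clause (Disproof `§ UpperOnly`): fixed-torus `β → ∞` semiclassics gives
  `β² n⁸ Cov_L(P_0^{01}, P_{ne₂}^{01}) ≥ c > 0` for `β ≥ B(L)`, `8n ≤ L`, with `c` uniform in `L`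
  (Laplace asymptotics of Wilson's measure near the flat-connection variety, leading Gaussian term
  `κ_{G,r} β⁻² ⟨K_{L,θ}(ne₂)²⟩_θ` (`κ_{G,r} > 0`; law of total covariance over the flat background
  `θ`), torons `O(β⁻² L⁻⁸)` non-negative on the axis; SU(2): two-sided band without convergence).
* `stub_pairUpper : Sig.stub_pairUpper` (`= KernelMargin → PairUpperFixedTorus`) — K2⁺: the matching fixed-torus UPPER
  bound for all plaquette pairs on all tori `L ≥ 1` (incl. `L < 8`, load-bearing for the shared
  `Γ`-levels), `β² |Cov| dist⁸ ≤ C` uniformly in `L` (Gaussian kernels of all polarisations decay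
  like `dist⁻⁴`; torons `β⁻² L⁻⁸ · dist⁸ ≤ β⁻²`).

**Composition.** `FemtoCurvatureTwoPoint_of : Sig.stub_kernelMargin → Sig.stub_axisLower →
Sig.stub_pairUpper → LangevinControlUV.FemtoCurvatureTwoPoint` — real proof, the ONLY theorem of the
file concluding the crux by name: `fixedTorusTwoSided_of` (merge thresholds, axis upper
bound from the pair bound at `dist(0, ne₂) = n`) then `encoding_at` (the generic-step encoding at
fixed `(G, r)`, sorry-free); `encoding : FixedTorusTwoSided → ∀ G r, CruxAt r` and
`cruxAt_of_deepBand : DeepBandTwoPoint → ∀ G r, CruxAt r` are its corollaries in the unbundled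
form (`femtoCurvatureTwoPoint_iff_cruxAt : crux ↔ ∀ G r, CruxAt r` is `Iff.rfl`).

**Disproof used** (`Cruxes/FemtoCurvatureTwoPoint/Disproof.lean`, cdisprove gen 1 v3; landed
extracts imported above and elaborated with this file): no `_false_without_` theorem exists for
this crux; the stub set honours `§ UpperOnly` / `Negative.UpperOnly.exists_upperOnly` (the lower
bound is the unique content — it is isolated as `stub_axisLower`, rank "hardest"),
`§ LoadBearing` / `Negative.UnfaithfulFalse` (faithfulness: both analytic stubs are stated over
`r : LatticeRep G`, never a bare `ρ`), `§ Resists 3` / `Negative.FiniteGroup*` (connectedness: both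
analytic stubs assume `IsCompactSimpleLieGroup G`; for finite `G` `stub_axisLower` would be FALSE,
`Cov ≍ e^{-cβ}`), `Negative.ForcedDividend.no_shape_floor` (the encoded `Γ` has levels
`4^{-k} → 0`, no floor), `Negative.PlaquetteFreezing` (consistent: `β² Cov` bounded ⇒ `Cov → 0`),
and `§ Dissection` (`FixedTorusTwoSided ⇒ ESFB` with `K = |C|/c`; this file supplies the converse
"encoding direction" the Disproof leaves to provers).

Honesty (card item (5), all three triage notes): this line closes 9363 AS TYPED through the
`∃ a` / free-`Γ` loophole; its unit map decays as slowly as the thresholds dictate (`a ≫ a_AF`), so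
the `∀ a`-items 9365–9367 inherit nothing from this witness. The repair `MonotoneOn Γ (Ioc 0 ℓ₀)`
(or `Continuous a`) kills `encoding` (levels `4^{-k}` decrease along increasing arguments); K1/K2±
survive any repair as the `β → ∞` boundary layer of the honest statement.
-/

noncomputable section

open scoped BigOperators
open MeasureTheory Filter Topology

namespace Summit.QuantumFields.YangMills.Cruxes.FemtoCurvatureTwoPoint.GenericStepGammaEncoding

open Literature.MathematicalPhysics.QuantumFieldTheory

/-! ## § Statements -/

/-- Squared lattice momentum component `k̂_μ² = 4 sin²(π k_μ / L)`. -/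
def khatSq (L : ℕ) (q : ZMod L) : ℝ :=
  (2 * Real.sin (Real.pi * (q.val : ℝ) / L)) ^ 2

/-- The zero-mode-removed periodic **field-strength kernel** of the `(0,1)`-plaquette on `(ℤ/L)⁴`
(tree-level `⟨F₀₁(0) F₀₁(x)⟩` per colour, Feynman gauge, unit coupling):
`K_L(x) = L⁻⁴ Σ_{k ≠ 0} (k̂₀² + k̂₁²) / k̂² · cos(2π k·x / L)`.
Numerically `π² n⁴ K_L(n e₂)` = 0.6787 (n = 1, L = 8), 1.760 (n = 2), 1.807 (n = 3), → 1. -/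
def fsKernel (L : ℕ) [NeZero L] (x : Fin 4 → ZMod L) : ℝ :=
  ((L : ℝ) ^ 4)⁻¹ * ∑ k : Fin 4 → ZMod L,
    if k = 0 then 0 else
      (khatSq L (k 0) + khatSq L (k 1)) / (∑ μ : Fin 4, khatSq L (k μ)) *
        Real.cos (2 * Real.pi * (∑ μ : Fin 4, ((k μ).val : ℝ) * ((x μ).val : ℝ)) / L)

/-- **K1 — field-strength kernel margin** (card `FieldStrengthKernelMargin`, zero twist).
Uniformly in the torus size: `c ≤ n⁸ K_L(n e₂)² ≤ C` for `1 ≤ n`, `8n ≤ L` (the direct term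
`1/(π² n⁴)` beats images and the zero-mode subtraction by a relative margin `< 1 %`; lattice values
at `n ≤ 3` computed), and `K_L(x)² · dist(0,x)⁸ ≤ C` for every `x ≠ 0`. Provable now (finite
Fourier analysis / Poisson summation against the zero-spherical-mean continuum kernel
`(4|y|⁻⁴ − 8ρ²|y|⁻⁶)/(4π²)`). -/
def KernelMargin : Prop :=
  ∃ c C : ℝ, 0 < c ∧ ∀ (L : ℕ) [NeZero L],
    (∀ n : ℕ, 1 ≤ n → 8 * n ≤ L →
      c ≤ (n : ℝ) ^ 8 * fsKernel L (Pi.single (2 : Fin 4) ((n : ℕ) : ZMod L)) ^ 2 ∧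
        (n : ℝ) ^ 8 * fsKernel L (Pi.single (2 : Fin 4) ((n : ℕ) : ZMod L)) ^ 2 ≤ C) ∧
    (∀ x : Fin 4 → ZMod L, x ≠ 0 →
      fsKernel L x ^ 2 * Real.sqrt (∑ k : Fin 4, (((x k).valMinAbs : ℤ) : ℝ) ^ 2) ^ 8 ≤ C)

/-- **K2⁻ — fixed-torus axis LOWER bound, `L`-uniform constant** (the load-bearing half of the
card's C⁺ `FixedTorusSemiclassicalTwoPoint`). For every compact simple `G` and faithful unitary
`r` there are per-torus thresholds `B(L)` and ONE `c > 0` such that on every torus `(ℤ/L)⁴`, for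
`β ≥ B(L)`: `c ≤ β² · n⁸ · Cov_{L,β}(P_0^{01}, P_{ne₂}^{01})` for `1 ≤ n`, `8n ≤ L`.
(Per-`L` `β → ∞` Laplace asymptotics near the flat variety; leading term
`κ_{G,r} β⁻² ⟨K_{L,θ}(ne₂)²⟩_θ ≥ κ_{G,r} β⁻² inf_θ K_{L,θ}(ne₂)²` with `κ_{G,r} > 0`, kernel margin
uniform in the flat twist `θ`; toron floor `Var_θ E[P|θ] ≥ 0`; cross terms relative `(n/L)⁴`;
thresholds `B(L)` may be astronomically large — only the LIMITING constants are uniform.) -/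
def AxisLowerFixedTorus : Prop :=
  ∀ (G : Type) [Group G] [TopologicalSpace G] [IsTopologicalGroup G] [CompactSpace G],
    IsCompactSimpleLieGroup G →
    letI : MeasurableSpace G := borel G
    haveI : BorelSpace G := ⟨rfl⟩
    ∀ (r : LatticeRep G), ∃ (B : ℕ → ℝ) (c : ℝ), 0 < c ∧
      ∀ (L : ℕ) [NeZero L] (β : ℝ), B L ≤ β →
        let P : (Fin 4 → ZMod L) → Fin 4 → Fin 4 → GaugeConfig 4 L G → ℝ :=
          fun x i j U => (r.N : ℝ) - (r.ρ (plaquetteHolonomy U x i j)).trace.re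
        let E : (GaugeConfig 4 L G → ℝ) → ℝ := fun F => wilsonExpectation (d := 4) (L := L) r.ρ β F
        let cov : (GaugeConfig 4 L G → ℝ) → (GaugeConfig 4 L G → ℝ) → ℝ :=
          fun F F' => E (fun U => F U * F' U) - E F * E F'
        ∀ n : ℕ, 1 ≤ n → 8 * n ≤ L →
          c ≤ β ^ 2 * ((n : ℝ) ^ 8 * cov (P 0 0 1) (P (Pi.single (2 : Fin 4) ((n : ℕ) : ZMod L)) 0 1))

/-- **K2⁺ — fixed-torus all-pairs UPPER bound, `L`-uniform constant** (the upper half of C⁺,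
on EVERY torus `L ≥ 1` including `L < 8` — load-bearing, TRIAGE r1-1 (B): small tori share the
`Γ`-levels of large ones). For every compact simple `G`, faithful unitary `r`: thresholds `B(L)`
and ONE `C` with `β² · |Cov_{L,β}(P_x^{ij}, P_y^{i'j'})| · dist(x,y)⁸ ≤ C` for all `x ≠ y`,
`i ≠ j`, `i' ≠ j'`, `β ≥ B(L)` (torus Euclidean distance). (Gaussian kernels of every
polarisation are `O(dist⁻⁴)` uniformly in `L`; torons `O(β⁻² L⁻⁸)` with `dist ≤ L`.) -/
def PairUpperFixedTorus : Prop :=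
  ∀ (G : Type) [Group G] [TopologicalSpace G] [IsTopologicalGroup G] [CompactSpace G],
    IsCompactSimpleLieGroup G →
    letI : MeasurableSpace G := borel G
    haveI : BorelSpace G := ⟨rfl⟩
    ∀ (r : LatticeRep G), ∃ (B : ℕ → ℝ) (C : ℝ),
      ∀ (L : ℕ) [NeZero L] (β : ℝ), B L ≤ β →
        let P : (Fin 4 → ZMod L) → Fin 4 → Fin 4 → GaugeConfig 4 L G → ℝ :=
          fun x i j U => (r.N : ℝ) - (r.ρ (plaquetteHolonomy U x i j)).trace.re
        let E : (GaugeConfig 4 L G → ℝ) → ℝ := fun F => wilsonExpectation (d := 4) (L := L) r.ρ β F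
        let cov : (GaugeConfig 4 L G → ℝ) → (GaugeConfig 4 L G → ℝ) → ℝ :=
          fun F F' => E (fun U => F U * F' U) - E F * E F'
        let dist : (Fin 4 → ZMod L) → (Fin 4 → ZMod L) → ℝ :=
          fun x y => Real.sqrt (∑ k : Fin 4, (((x k - y k).valMinAbs : ℤ) : ℝ) ^ 2)
        ∀ (x y : Fin 4 → ZMod L) (i j i' j' : Fin 4), x ≠ y → i ≠ j → i' ≠ j' →
          β ^ 2 * (|cov (P x i j) (P y i' j')| * dist x y ^ 8) ≤ C

/-- **C⁺ of the card (`FixedTorusSemiclassicalTwoPoint`, sharpened threshold form).** Both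
clauses with ONE pair of constants `0 < c`, `C` uniform in `L`, each torus from its own
threshold `B(L)` on. No unit map, no shape, no coupling between `β` and `L`. -/
def FixedTorusTwoSided : Prop :=
  ∀ (G : Type) [Group G] [TopologicalSpace G] [IsTopologicalGroup G] [CompactSpace G],
    IsCompactSimpleLieGroup G →
    letI : MeasurableSpace G := borel G
    haveI : BorelSpace G := ⟨rfl⟩
    ∀ (r : LatticeRep G), ∃ (B : ℕ → ℝ) (c C : ℝ), 0 < c ∧
      ∀ (L : ℕ) [NeZero L] (β : ℝ), B L ≤ β →
        let P : (Fin 4 → ZMod L) → Fin 4 → Fin 4 → GaugeConfig 4 L G → ℝ :=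
          fun x i j U => (r.N : ℝ) - (r.ρ (plaquetteHolonomy U x i j)).trace.re
        let E : (GaugeConfig 4 L G → ℝ) → ℝ := fun F => wilsonExpectation (d := 4) (L := L) r.ρ β F
        let cov : (GaugeConfig 4 L G → ℝ) → (GaugeConfig 4 L G → ℝ) → ℝ :=
          fun F F' => E (fun U => F U * F' U) - E F * E F'
        let dist : (Fin 4 → ZMod L) → (Fin 4 → ZMod L) → ℝ :=
          fun x y => Real.sqrt (∑ k : Fin 4, (((x k - y k).valMinAbs : ℤ) : ℝ) ^ 2)
        (∀ n : ℕ, 1 ≤ n → 8 * n ≤ L →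
            c ≤ β ^ 2 * ((n : ℝ) ^ 8 * cov (P 0 0 1) (P (Pi.single (2 : Fin 4) ((n : ℕ) : ZMod L)) 0 1)) ∧
            β ^ 2 * ((n : ℝ) ^ 8 * cov (P 0 0 1) (P (Pi.single (2 : Fin 4) ((n : ℕ) : ZMod L)) 0 1)) ≤ C) ∧
        (∀ (x y : Fin 4 → ZMod L) (i j i' j' : Fin 4), x ≠ y → i ≠ j → i' ≠ j' →
            β ^ 2 * (|cov (P x i j) (P y i' j')| * dist x y ^ 8) ≤ C)

/-- The crux BODY at fixed data `(G, r)` (verbatim; `femtoCurvatureTwoPoint_iff_cruxAt` is `Iff.rfl`).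
Used only to state the fixed-data form `encoding_at` of the transfer. -/
def CruxAt {G : Type} [Group G] [TopologicalSpace G] [IsTopologicalGroup G] [CompactSpace G]
    [MeasurableSpace G] [BorelSpace G] (r : LatticeRep G) : Prop :=
  ∃ (a : ℝ → ℝ), ∃ (Γ : ℝ → ℝ) (β₀ ℓ₀ c C : ℝ), 0 < ℓ₀ ∧ 0 < c ∧ (∀ β, 0 < a β) ∧
    Filter.Tendsto a Filter.atTop (nhds 0) ∧ (∀ s : ℝ, 0 < s → s ≤ ℓ₀ → 0 < Γ s ∧ Γ s ≤ 1) ∧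
    ∀ (L : ℕ) [NeZero L] (β : ℝ), β₀ ≤ β → (L : ℝ) * a β ≤ ℓ₀ →
      let P : (Fin 4 → ZMod L) → Fin 4 → Fin 4 → GaugeConfig 4 L G → ℝ :=
        fun x i j U => (r.N : ℝ) - (r.ρ (plaquetteHolonomy U x i j)).trace.re
      let E : (GaugeConfig 4 L G → ℝ) → ℝ := fun F => wilsonExpectation (d := 4) (L := L) r.ρ β F
      let cov : (GaugeConfig 4 L G → ℝ) → (GaugeConfig 4 L G → ℝ) → ℝ :=
        fun F F' => E (fun U => F U * F' U) - E F * E F'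
      let dist : (Fin 4 → ZMod L) → (Fin 4 → ZMod L) → ℝ :=
        fun x y => Real.sqrt (∑ k : Fin 4, (((x k - y k).valMinAbs : ℤ) : ℝ) ^ 2)
      (∀ n : ℕ, 1 ≤ n → 8 * n ≤ L →
          c * Γ ((n : ℝ) * a β) ≤ (n : ℝ) ^ 8 * cov (P 0 0 1) (P (Pi.single (2 : Fin 4) ((n : ℕ) : ZMod L)) 0 1) ∧
          (n : ℝ) ^ 8 * cov (P 0 0 1) (P (Pi.single (2 : Fin 4) ((n : ℕ) : ZMod L)) 0 1) ≤ C * Γ ((n : ℝ) * a β)) ∧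
      (∀ (x y : Fin 4 → ZMod L) (i j i' j' : Fin 4), x ≠ y → i ≠ j → i' ≠ j' →
          |cov (P x i j) (P y i' j')| * dist x y ^ 8 ≤ C * Γ (dist x y * a β))

/-- The crux is literally `∀ G simple compact, ∀ r, CruxAt r` (definitional unbundling, as in
`Disproof.femtoCurvatureTwoPoint_iff`). -/
theorem femtoCurvatureTwoPoint_iff_cruxAt :
    Summit.QuantumFields.YangMills.Theses.LangevinControlUV.FemtoCurvatureTwoPoint ↔
      ∀ (G : Type) [Group G] [TopologicalSpace G] [IsTopologicalGroup G] [CompactSpace G],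
        IsCompactSimpleLieGroup G →
          letI : MeasurableSpace G := borel G
          haveI : BorelSpace G := ⟨rfl⟩
          ∀ r : LatticeRep G, CruxAt r :=
  Iff.rfl

/-! ## § Stubs (registered; genuine lemmas of the line, the only `sorry`s)

Shape (skeleton audit A12, as in the tree's accepted Lines files): each stub's statement is the `Prop`
`Sig.stub_<name>` (a by-name handle over the readable statements above; `Sig.stub_axisLower` and
`Sig.stub_pairUpper` carry the dependence on K1 as an implication), the registered obligation is
`theorem stub_<name> : Sig.stub_<name> := by sorry`, and the composition `FemtoCurvatureTwoPoint_of`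
takes exactly the three `Sig.stub_*` as hypotheses. -/

/-- Signature of stub K1: the kernel margin (`KernelMargin`). -/
def Sig.stub_kernelMargin : Prop := KernelMargin

/-- Signature of stub K2⁻: `KernelMargin → AxisLowerFixedTorus`. -/
def Sig.stub_axisLower : Prop := KernelMargin → AxisLowerFixedTorus

/-- Signature of stub K2⁺: `KernelMargin → PairUpperFixedTorus`. -/
def Sig.stub_pairUpper : Prop := KernelMargin → PairUpperFixedTorus

/-- **stub K1** (provable now; Lean L): the lattice field-strength kernel margin `KernelMargin`. -/
theorem stub_kernelMargin : Sig.stub_kernelMargin := by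
  sorry

/-- **stub K2⁻** (HARDEST, XL): fixed-torus semiclassical LOWER bound with `L`-uniform constant,
from the kernel margin: `KernelMargin → AxisLowerFixedTorus`. -/
theorem stub_axisLower : Sig.stub_axisLower := by
  sorry

/-- **stub K2⁺** (L): fixed-torus UPPER bound for all plaquette pairs on all tori, `L`-uniform
constant, from the kernel margin: `KernelMargin → PairUpperFixedTorus`. -/
theorem stub_pairUpper : Sig.stub_pairUpper := by
  sorry

/-! ## § Torus-distance bookkeeping -/

/-- Torus distances between distinct sites are square roots of positive integers. -/
theorem dist_eq_sqrt_nat {L : ℕ} (x y : Fin 4 → ZMod L) (hxy : x ≠ y) :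
    ∃ m : ℕ, 1 ≤ m ∧
      Real.sqrt (∑ k : Fin 4, (((x k - y k).valMinAbs : ℤ) : ℝ) ^ 2) = Real.sqrt (m : ℝ) := by
  refine ⟨∑ k : Fin 4, ((x k - y k).valMinAbs.natAbs) ^ 2, ?_, ?_⟩
  · obtain ⟨k, hk⟩ := Function.ne_iff.1 hxy
    have hne : (x k - y k).valMinAbs ≠ 0 := by
      rw [Ne, ZMod.valMinAbs_eq_zero, sub_eq_zero]; exact hk
    have h1 : 1 ≤ (x k - y k).valMinAbs.natAbs ^ 2 := by
      have : 1 ≤ (x k - y k).valMinAbs.natAbs := Nat.one_le_iff_ne_zero.2 (Int.natAbs_ne_zero.2 hne)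
      nlinarith
    exact h1.trans (Finset.single_le_sum (f := fun i => ((x i - y i).valMinAbs.natAbs) ^ 2)
      (fun i _ => Nat.zero_le _) (Finset.mem_univ k))
  · congr 1
    push_cast
    refine Finset.sum_congr rfl fun k _ => ?_
    rw [Nat.cast_natAbs, Int.cast_abs, sq_abs]

/-- The axis site `n e₂` is not the origin for `1 ≤ n`, `8n ≤ L`. -/
theorem axis_ne {L n : ℕ} (hn : 1 ≤ n) (h8 : 8 * n ≤ L) :
    (0 : Fin 4 → ZMod L) ≠ Pi.single (2 : Fin 4) ((n : ℕ) : ZMod L) := by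
  intro h
  have h2 := congr_fun h (2 : Fin 4)
  simp only [Pi.zero_apply, Pi.single_eq_same] at h2
  have hdvd : L ∣ n := (ZMod.natCast_eq_zero_iff n L).1 h2.symm
  have hL : L ≤ n := Nat.le_of_dvd (by omega) hdvd
  omega

/-- The torus distance from the origin to `n e₂` is `n` (`8n ≤ L`). -/
theorem dist_axis {L n : ℕ} [NeZero L] (hn : 1 ≤ n) (h8 : 8 * n ≤ L) :
    Real.sqrt (∑ k : Fin 4,
      ((((0 : Fin 4 → ZMod L) k -
        (Pi.single (2 : Fin 4) ((n : ℕ) : ZMod L) : Fin 4 → ZMod L) k).valMinAbs : ℤ) : ℝ) ^ 2)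
      = n := by
  set y : Fin 4 → ZMod L := Pi.single (2 : Fin 4) ((n : ℕ) : ZMod L) with hy
  have hval : ((n : ℕ) : ZMod L).val = n := ZMod.val_natCast_of_lt (by omega)
  have hhalf : ((n : ℕ) : ZMod L).valMinAbs = n := ZMod.valMinAbs_natCast_of_le_half (by omega)
  have hneg : (-((n : ℕ) : ZMod L)).valMinAbs = -(n : ℤ) := by
    rw [ZMod.valMinAbs_neg_of_ne_half, hhalf]
    rw [hval]; omega
  have h0 : y 0 = 0 := by simp [hy]
  have h1 : y 1 = 0 := by simp [hy]
  have h2 : y 2 = ((n : ℕ) : ZMod L) := by simp [hy]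
  have h3 : y 3 = 0 := by simp [hy]
  have hsum : ∑ k : Fin 4, ((((0 : Fin 4 → ZMod L) k - y k).valMinAbs : ℤ) : ℝ) ^ 2
      = (n : ℝ) ^ 2 := by
    simp only [Fin.sum_univ_four, Pi.zero_apply, zero_sub, h0, h1, h2, h3, neg_zero,
      ZMod.valMinAbs_zero, hneg]
    push_cast
    ring
  rw [hsum, Real.sqrt_sq (Nat.cast_nonneg n)]

/-! ## § Merging the two analytic stubs into C⁺ -/

/-- `K2⁻ ∧ K2⁺ ⇒ C⁺`: merge the thresholds; the axis upper bound is the pair bound at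
`(0, n e₂)`, where `dist = n`. -/
theorem fixedTorusTwoSided_of : AxisLowerFixedTorus → PairUpperFixedTorus → FixedTorusTwoSided := by
  intro hA hU G _ _ _ _ hG r
  obtain ⟨B₁, c, hc, HA⟩ := hA G hG r
  obtain ⟨B₂, C, HU⟩ := hU G hG r
  refine ⟨fun L => max (B₁ L) (B₂ L), c, |C|, hc, ?_⟩
  intro L _ β hβ
  have hA' := HA L β ((le_max_left _ _).trans hβ)
  have hU' := HU L β ((le_max_right _ _).trans hβ)
  refine ⟨fun n hn h8 => ⟨hA' n hn h8, ?_⟩,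
    fun x y i j i' j' hxy hij hij' => (hU' x y i j i' j' hxy hij hij').trans (le_abs_self C)⟩
  have h01 : (0 : Fin 4) ≠ 1 := by decide
  have h := hU' 0 (Pi.single (2 : Fin 4) ((n : ℕ) : ZMod L)) 0 1 0 1 (axis_ne hn h8) h01 h01
  have key : ∀ (Y D : ℝ), D = n → β ^ 2 * (|Y| * D ^ 8) ≤ C → β ^ 2 * ((n : ℝ) ^ 8 * Y) ≤ |C| := by
    intro Y D hD hY
    subst hD
    have h1 : (n : ℝ) ^ 8 * Y ≤ |Y| * (n : ℝ) ^ 8 := by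
      rw [mul_comm]; exact mul_le_mul_of_nonneg_right (le_abs_self Y) (by positivity)
    have h2 : β ^ 2 * ((n : ℝ) ^ 8 * Y) ≤ β ^ 2 * (|Y| * (n : ℝ) ^ 8) :=
      mul_le_mul_of_nonneg_left h1 (sq_nonneg β)
    exact h2.trans (hY.trans (le_abs_self C))
  exact key _ _ (dist_axis (L := L) hn h8) h

/-! ## § The generic-step encoding (proved): `C⁺ ⇒ crux`

### Step index `k(β)` with `2^k ≤ β < 2^{k+1}` (as in `Ideator2.crux_of_deepBand`) -/

/-- Step index `k(β) = ⌊log₂ ⌊β⌋₊⌋`. -/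
def stepIdx (β : ℝ) : ℕ := Nat.log 2 ⌊β⌋₊

theorem two_pow_stepIdx_le {β : ℝ} (hβ : 1 ≤ β) : (2 : ℝ) ^ stepIdx β ≤ β := by
  have hfl : ⌊β⌋₊ ≠ 0 := (Nat.floor_pos.2 hβ).ne'
  have h1 : 2 ^ Nat.log 2 ⌊β⌋₊ ≤ ⌊β⌋₊ := Nat.pow_log_le_self 2 hfl
  have h2 : ((2 ^ Nat.log 2 ⌊β⌋₊ : ℕ) : ℝ) ≤ (⌊β⌋₊ : ℝ) := by exact_mod_cast h1
  have h3 : (⌊β⌋₊ : ℝ) ≤ β := Nat.floor_le (by linarith)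
  have h4 : ((2 ^ Nat.log 2 ⌊β⌋₊ : ℕ) : ℝ) = (2 : ℝ) ^ stepIdx β := by
    rw [stepIdx]; push_cast; ring
  rw [← h4]
  exact h2.trans h3

theorem lt_two_pow_stepIdx_succ (β : ℝ) : β < (2 : ℝ) ^ (stepIdx β + 1) := by
  have h1 : ⌊β⌋₊ < 2 ^ (Nat.log 2 ⌊β⌋₊ + 1) := Nat.lt_pow_succ_log_self (by norm_num) ⌊β⌋₊
  have h2 : ⌊β⌋₊ + 1 ≤ 2 ^ (Nat.log 2 ⌊β⌋₊ + 1) := h1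
  have h3 : ((⌊β⌋₊ + 1 : ℕ) : ℝ) ≤ ((2 ^ (Nat.log 2 ⌊β⌋₊ + 1) : ℕ) : ℝ) := by exact_mod_cast h2
  have h4 : β < (⌊β⌋₊ : ℝ) + 1 := Nat.lt_floor_add_one β
  calc β < (⌊β⌋₊ : ℝ) + 1 := h4
    _ = ((⌊β⌋₊ + 1 : ℕ) : ℝ) := by push_cast; ring
    _ ≤ ((2 ^ (Nat.log 2 ⌊β⌋₊ + 1) : ℕ) : ℝ) := h3
    _ = (2 : ℝ) ^ (stepIdx β + 1) := by rw [stepIdx]; push_cast; ring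

/-- `2^K ≤ β ⇒ K ≤ k(β)`: the step index is unbounded along `β → ∞`. -/
theorem le_stepIdx_of_le {K : ℕ} {β : ℝ} (h : (2 : ℝ) ^ K ≤ β) : K ≤ stepIdx β := by
  have h0 : (0 : ℝ) ≤ β := le_trans (by positivity) h
  have h1 : (2 : ℕ) ^ K ≤ ⌊β⌋₊ := by
    refine Nat.le_floor ?_
    push_cast
    exact h
  unfold stepIdx
  exact Nat.le_log_of_pow_le (by norm_num) h1

/-! ### The threshold ladder -/

/-- Monotone envelope of a threshold function: `T(L) = L + Σ_{i ≤ L} |B i|`. -/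
def env (B : ℕ → ℝ) (L : ℕ) : ℝ := (L : ℝ) + ∑ i ∈ Finset.range (L + 1), |B i|

theorem le_env (B : ℕ → ℝ) (L : ℕ) : (L : ℝ) ≤ env B L := by
  have := Finset.sum_nonneg fun i (_ : i ∈ Finset.range (L + 1)) => abs_nonneg (B i)
  simp only [env]; linarith

theorem self_le_env (B : ℕ → ℝ) (L : ℕ) : B L ≤ env B L := by
  have h1 : |B L| ≤ ∑ i ∈ Finset.range (L + 1), |B i| :=
    Finset.single_le_sum (fun i _ => abs_nonneg (B i)) (Finset.self_mem_range_succ L)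
  have h2 := le_abs_self (B L)
  have h3 : (0 : ℝ) ≤ L := Nat.cast_nonneg L
  simp only [env]; linarith

theorem env_mono (B : ℕ → ℝ) {L L' : ℕ} (h : L ≤ L') : env B L ≤ env B L' := by
  simp only [env]
  have h1 : ∑ i ∈ Finset.range (L + 1), |B i| ≤ ∑ i ∈ Finset.range (L' + 1), |B i| :=
    Finset.sum_le_sum_of_subset_of_nonneg (Finset.range_mono (by omega)) fun i _ _ => abs_nonneg (B i)
  have h2 : (L : ℝ) ≤ L' := by exact_mod_cast h
  linarith

/-- The ladder: `L_k = max {L ≤ 2^k : T(L) ≤ 2^k}` — the largest torus validated in step `k`. -/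
def ladder (B : ℕ → ℝ) (k : ℕ) : ℕ := Nat.findGreatest (fun L => env B L ≤ (2 : ℝ) ^ k) (2 ^ k)

theorem le_ladder (B : ℕ → ℝ) {k L : ℕ} (h : env B L ≤ (2 : ℝ) ^ k) : L ≤ ladder B k := by
  have h1 : (L : ℝ) ≤ (2 : ℝ) ^ k := (le_env B L).trans h
  have h2 : L ≤ 2 ^ k := by exact_mod_cast h1
  exact Nat.le_findGreatest (P := fun L => env B L ≤ (2 : ℝ) ^ k) h2 h

theorem env_ladder_le (B : ℕ → ℝ) {k : ℕ} (hk : ladder B k ≠ 0) : env B (ladder B k) ≤ (2 : ℝ) ^ k :=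
  Nat.findGreatest_of_ne_zero (P := fun L => env B L ≤ (2 : ℝ) ^ k) rfl hk

/-- On a torus validated in step `k` the threshold is passed for every `β ≥ 2^k`. -/
theorem threshold_le (B : ℕ → ℝ) {k L : ℕ} (hL1 : 1 ≤ L) (hL : L ≤ ladder B k) {β : ℝ}
    (hβ : (2 : ℝ) ^ k ≤ β) : B L ≤ β := by
  have hk : ladder B k ≠ 0 := by omega
  exact (self_le_env B L).trans (((env_mono B hL).trans (env_ladder_le B hk)).trans hβ)

/-! ### Generic step values `α_k = u_k (1 + t 2^{-k})`, `u_k = 1/(L_k + 1)` -/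

/-- The step values `α_k = (1 + t 2^{-k}) / (L_k + 1)`. -/
def alphaEnc (B : ℕ → ℝ) (t : ℝ) (k : ℕ) : ℝ :=
  ((ladder B k : ℝ) + 1)⁻¹ * (1 + t * ((2 : ℝ) ^ k)⁻¹)

theorem alphaEnc_pos (B : ℕ → ℝ) {t : ℝ} (ht : 0 ≤ t) (k : ℕ) : 0 < alphaEnc B t k := by
  unfold alphaEnc; positivity

theorem alphaEnc_le (B : ℕ → ℝ) {t : ℝ} (ht1 : t ≤ 1) (k : ℕ) :
    alphaEnc B t k ≤ 2 / ((ladder B k : ℝ) + 1) := by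
  have hx : ((2 : ℝ) ^ k)⁻¹ ≤ 1 := inv_le_one_of_one_le₀ (one_le_pow₀ (by norm_num))
  have hx0 : (0 : ℝ) ≤ ((2 : ℝ) ^ k)⁻¹ := by positivity
  have h1 : 1 + t * ((2 : ℝ) ^ k)⁻¹ ≤ 2 := by nlinarith [mul_le_mul ht1 hx hx0 zero_le_one]
  have hpos : (0 : ℝ) < ((ladder B k : ℝ) + 1)⁻¹ := by positivity
  calc alphaEnc B t k = ((ladder B k : ℝ) + 1)⁻¹ * (1 + t * ((2 : ℝ) ^ k)⁻¹) := rfl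
    _ ≤ ((ladder B k : ℝ) + 1)⁻¹ * 2 := mul_le_mul_of_nonneg_left h1 hpos.le
    _ = 2 / ((ladder B k : ℝ) + 1) := by rw [mul_comm, div_eq_mul_inv]

/-- **Femto ⇒ validated**: `L · α_k ≤ 1` forces `L ≤ L_k` (because `α_k > 1/(L_k + 1)`). -/
theorem le_ladder_of_femto (B : ℕ → ℝ) {t : ℝ} (ht : 0 < t) {k L : ℕ}
    (hL : (L : ℝ) * alphaEnc B t k ≤ 1) : L ≤ ladder B k := by
  by_contra hlt
  have hle : (ladder B k : ℝ) + 1 ≤ L := by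
    exact_mod_cast Nat.lt_iff_add_one_le.1 (not_le.1 hlt)
  have hpos : (0 : ℝ) < (ladder B k : ℝ) + 1 := by positivity
  have hx : (0 : ℝ) < t * ((2 : ℝ) ^ k)⁻¹ := by positivity
  have h1 : (L : ℝ) * alphaEnc B t k = (L : ℝ) * (1 + t * ((2 : ℝ) ^ k)⁻¹) / ((ladder B k : ℝ) + 1) := by
    unfold alphaEnc; ring
  rw [h1, div_le_one hpos] at hL
  nlinarith


/-- **Genericity.** For positive `u_k` there is `t ∈ [1/2, 1]` such that the level sets
`{√m · u_k (1 + t 2^{-k}) : m ≥ 1}` of distinct steps are disjoint: for `k ≠ k'` and fixed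
`m, m'` the collision equation is affine in `t` with at most one root (two roots force
`2^{-k} = 2^{-k'}`), so the bad `t` form a countable, Lebesgue-null set. -/
theorem exists_generic (u : ℕ → ℝ) (hu : ∀ k, 0 < u k) :
    ∃ t : ℝ, 1 / 2 ≤ t ∧ t ≤ 1 ∧ ∀ (k k' m m' : ℕ), k ≠ k' → 1 ≤ m → 1 ≤ m' →
      Real.sqrt m * (u k * (1 + t * ((2 : ℝ) ^ k)⁻¹)) ≠
        Real.sqrt m' * (u k' * (1 + t * ((2 : ℝ) ^ k')⁻¹)) := by
  classical
  let Bad : Set ℝ := ⋃ k : ℕ, ⋃ k' : ℕ, ⋃ m : ℕ, ⋃ m' : ℕ,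
    {t : ℝ | k ≠ k' ∧ 1 ≤ m ∧ 1 ≤ m' ∧
      Real.sqrt m * (u k * (1 + t * ((2 : ℝ) ^ k)⁻¹)) =
        Real.sqrt m' * (u k' * (1 + t * ((2 : ℝ) ^ k')⁻¹))}
  have hsub : ∀ (k k' m m' : ℕ), Set.Subsingleton {t : ℝ | k ≠ k' ∧ 1 ≤ m ∧ 1 ≤ m' ∧
      Real.sqrt m * (u k * (1 + t * ((2 : ℝ) ^ k)⁻¹)) =
        Real.sqrt m' * (u k' * (1 + t * ((2 : ℝ) ^ k')⁻¹))} := by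
    intro k k' m m' t ht t' ht'
    obtain ⟨hkk, hm, -, hteq⟩ := ht
    obtain ⟨-, -, -, ht'eq⟩ := ht'
    have hP : 0 < Real.sqrt m * u k := mul_pos (Real.sqrt_pos.2 (by exact_mod_cast hm)) (hu k)
    have e1 : (Real.sqrt m * u k * ((2 : ℝ) ^ k)⁻¹ - Real.sqrt m' * u k' * ((2 : ℝ) ^ k')⁻¹) *
        (t - t') = 0 := by
      linear_combination hteq - ht'eq
    rcases mul_eq_zero.1 e1 with hA | htt
    · exfalso
      have e2 : Real.sqrt m * u k = Real.sqrt m' * u k' := by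
        linear_combination hteq - t * hA
      have e3 : Real.sqrt m * u k * ((2 : ℝ) ^ k)⁻¹ = Real.sqrt m * u k * ((2 : ℝ) ^ k')⁻¹ := by
        linear_combination hA - ((2 : ℝ) ^ k')⁻¹ * e2
      have e4 : ((2 : ℝ) ^ k)⁻¹ = ((2 : ℝ) ^ k')⁻¹ := mul_left_cancel₀ hP.ne' e3
      have e5 : (2 : ℝ) ^ k = (2 : ℝ) ^ k' := inv_injective e4
      have e6 : (2 : ℕ) ^ k = 2 ^ k' := by exact_mod_cast e5
      exact hkk (Nat.pow_right_injective le_rfl e6)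
    · exact sub_eq_zero.1 htt
  have hcount : Bad.Countable :=
    Set.countable_iUnion fun k => Set.countable_iUnion fun k' =>
      Set.countable_iUnion fun m => Set.countable_iUnion fun m' => (hsub k k' m m').countable
  have hB0 : volume Bad = 0 := hcount.measure_zero volume
  have hIcc : volume (Set.Icc (1 / 2 : ℝ) 1) ≠ 0 := by
    rw [Real.volume_Icc, Ne, ENNReal.ofReal_eq_zero]; norm_num
  have hns : ¬ Set.Icc (1 / 2 : ℝ) 1 ⊆ Bad := fun hs => hIcc (measure_mono_null hs hB0)
  obtain ⟨t, htI, htB⟩ := Set.not_subset.1 hns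
  refine ⟨t, htI.1, htI.2, fun k k' m m' hkk hm hm' heq => htB ?_⟩
  simp only [Bad, Set.mem_iUnion, Set.mem_setOf_eq]
  exact ⟨k, k', m, m', hkk, hm, hm', heq⟩

/-! ### The encoded shape `Γ` -/

open Classical in
/-- `Γ(√m · α_k) = 4^{-k}` on the level sets (`m ≥ 1`), `Γ = 1` elsewhere. -/
def gammaEnc (α : ℕ → ℝ) (s : ℝ) : ℝ :=
  if h : ∃ k m : ℕ, 1 ≤ m ∧ s = Real.sqrt m * α k then ((4 : ℝ) ^ (Classical.choose h))⁻¹ else 1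

theorem gammaEnc_pos (α : ℕ → ℝ) (s : ℝ) : 0 < gammaEnc α s := by
  unfold gammaEnc; split_ifs <;> positivity

theorem gammaEnc_le_one (α : ℕ → ℝ) (s : ℝ) : gammaEnc α s ≤ 1 := by
  unfold gammaEnc
  split_ifs
  · exact inv_le_one_of_one_le₀ (one_le_pow₀ (by norm_num))
  · exact le_rfl

theorem gammaEnc_eq {α : ℕ → ℝ}
    (hgen : ∀ (k k' m m' : ℕ), k ≠ k' → 1 ≤ m → 1 ≤ m' →
      Real.sqrt m * α k ≠ Real.sqrt m' * α k')
    (k m : ℕ) (hm : 1 ≤ m) : gammaEnc α (Real.sqrt m * α k) = ((4 : ℝ) ^ k)⁻¹ := by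
  have h : ∃ k' m' : ℕ, 1 ≤ m' ∧ Real.sqrt m * α k = Real.sqrt m' * α k' := ⟨k, m, hm, rfl⟩
  unfold gammaEnc
  rw [dif_pos h]
  obtain ⟨m', hm', heq⟩ := Classical.choose_spec h
  have hk : Classical.choose h = k := by
    by_contra hne
    exact hgen k (Classical.choose h) m m' (Ne.symm hne) hm hm' heq
  rw [hk]

/-! ### One step of arithmetic: `2^k ≤ β < 2^{k+1}` turns `[c, C]·β⁻²` into levels -/

theorem band_to_levels {β c C Y : ℝ} {k : ℕ} (h2k : (2 : ℝ) ^ k ≤ β) (hβlt : β < (2 : ℝ) ^ (k + 1))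
    (hc : 0 < c) (h_lo : c ≤ β ^ 2 * Y) (h_hi : β ^ 2 * Y ≤ C) :
    c / 4 * ((4 : ℝ) ^ k)⁻¹ ≤ Y ∧ Y ≤ |C| * ((4 : ℝ) ^ k)⁻¹ := by
  have h2kpos : 0 < (2 : ℝ) ^ k := by positivity
  have hβpos : 0 < β := h2kpos.trans_le h2k
  have hβ2 : 0 < β ^ 2 := by positivity
  have h4k : (4 : ℝ) ^ k = ((2 : ℝ) ^ k) ^ 2 := by
    rw [show (4 : ℝ) = 2 ^ 2 by norm_num, ← pow_mul, mul_comm, pow_mul]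
  have h4k1 : (4 : ℝ) ^ (k + 1) = ((2 : ℝ) ^ (k + 1)) ^ 2 := by
    rw [show (4 : ℝ) = 2 ^ 2 by norm_num, ← pow_mul, mul_comm, pow_mul]
  have hle : (4 : ℝ) ^ k ≤ β ^ 2 := by rw [h4k]; exact pow_le_pow_left₀ h2kpos.le h2k 2
  have hlt : β ^ 2 ≤ (4 : ℝ) ^ (k + 1) := by
    rw [h4k1]; exact (pow_lt_pow_left₀ hβlt hβpos.le two_ne_zero).le
  have h4pos : 0 < (4 : ℝ) ^ k := by positivity
  constructor
  · have hY : c / β ^ 2 ≤ Y := by rw [div_le_iff₀ hβ2]; linarith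
    have h1 : c / (4 : ℝ) ^ (k + 1) ≤ c / β ^ 2 := div_le_div_of_nonneg_left hc.le hβ2 hlt
    have h2 : c / 4 * ((4 : ℝ) ^ k)⁻¹ = c / (4 : ℝ) ^ (k + 1) := by rw [pow_succ]; field_simp
    rw [h2]; exact h1.trans hY
  · have hY : Y ≤ C / β ^ 2 := by rw [le_div_iff₀ hβ2]; linarith
    have h1 : C / β ^ 2 ≤ |C| / β ^ 2 := div_le_div_of_nonneg_right (le_abs_self C) hβ2.le
    have h2 : |C| / β ^ 2 ≤ |C| / (4 : ℝ) ^ k := div_le_div_of_nonneg_left (abs_nonneg C) h4pos hle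
    rw [← div_eq_mul_inv]
    exact hY.trans (h1.trans h2)

theorem allpairs_to_levels {β C Y : ℝ} {k : ℕ} (h2k : (2 : ℝ) ^ k ≤ β) (_hY : 0 ≤ Y)
    (h : β ^ 2 * Y ≤ C) : Y ≤ |C| * ((4 : ℝ) ^ k)⁻¹ := by
  have h2kpos : 0 < (2 : ℝ) ^ k := by positivity
  have hβpos : 0 < β := h2kpos.trans_le h2k
  have hβ2 : 0 < β ^ 2 := by positivity
  have h4k : (4 : ℝ) ^ k = ((2 : ℝ) ^ k) ^ 2 := by
    rw [show (4 : ℝ) = 2 ^ 2 by norm_num, ← pow_mul, mul_comm, pow_mul]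
  have hle : (4 : ℝ) ^ k ≤ β ^ 2 := by rw [h4k]; exact pow_le_pow_left₀ h2kpos.le h2k 2
  have h4pos : 0 < (4 : ℝ) ^ k := by positivity
  have h0 : Y ≤ C / β ^ 2 := by rw [le_div_iff₀ hβ2]; linarith
  have h1 : C / β ^ 2 ≤ |C| / β ^ 2 := div_le_div_of_nonneg_right (le_abs_self C) hβ2.le
  have h2 : |C| / β ^ 2 ≤ |C| / (4 : ℝ) ^ k := div_le_div_of_nonneg_left (abs_nonneg C) h4pos hle
  rw [← div_eq_mul_inv]
  exact h0.trans (h1.trans h2)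

/-! ### The transfer `C⁺ ⇒ crux` -/

/-- **Encoding at fixed data (the card's `crux_of_encoding`, PROVED).** From the fixed-torus
two-sided clauses at `(G, r)` with thresholds `B` and constants `0 < c`, `C`, the crux body at
`(G, r)`: `ℓ₀ = 1`, `β₀ = 1`, unit map `a(β) = α_{k(β)}`, `α_k = (1 + t 2^{-k})/(L_k + 1)` (`t`
generic, `L_k` the threshold ladder of `B`), shape `Γ(√m α_k) = 4^{-k}` (else `1`), constants
`c/4` and `|C|`. -/
theorem encoding_at {G : Type} [Group G] [TopologicalSpace G] [IsTopologicalGroup G] [CompactSpace G]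
    [MeasurableSpace G] [BorelSpace G] (r : LatticeRep G) {B : ℕ → ℝ} {c C : ℝ} (hc : 0 < c)
    (H : ∀ (L : ℕ) [NeZero L] (β : ℝ), B L ≤ β →
        let P : (Fin 4 → ZMod L) → Fin 4 → Fin 4 → GaugeConfig 4 L G → ℝ :=
          fun x i j U => (r.N : ℝ) - (r.ρ (plaquetteHolonomy U x i j)).trace.re
        let E : (GaugeConfig 4 L G → ℝ) → ℝ := fun F => wilsonExpectation (d := 4) (L := L) r.ρ β F
        let cov : (GaugeConfig 4 L G → ℝ) → (GaugeConfig 4 L G → ℝ) → ℝ :=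
          fun F F' => E (fun U => F U * F' U) - E F * E F'
        let dist : (Fin 4 → ZMod L) → (Fin 4 → ZMod L) → ℝ :=
          fun x y => Real.sqrt (∑ k : Fin 4, (((x k - y k).valMinAbs : ℤ) : ℝ) ^ 2)
        (∀ n : ℕ, 1 ≤ n → 8 * n ≤ L →
            c ≤ β ^ 2 * ((n : ℝ) ^ 8 * cov (P 0 0 1) (P (Pi.single (2 : Fin 4) ((n : ℕ) : ZMod L)) 0 1)) ∧
            β ^ 2 * ((n : ℝ) ^ 8 * cov (P 0 0 1) (P (Pi.single (2 : Fin 4) ((n : ℕ) : ZMod L)) 0 1)) ≤ C) ∧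
        (∀ (x y : Fin 4 → ZMod L) (i j i' j' : Fin 4), x ≠ y → i ≠ j → i' ≠ j' →
            β ^ 2 * (|cov (P x i j) (P y i' j')| * dist x y ^ 8) ≤ C)) :
    CruxAt r := by
  -- generic step values over the threshold ladder of `B`
  obtain ⟨t, ht1, ht2, hgen⟩ :=
    exists_generic (fun k => ((ladder B k : ℝ) + 1)⁻¹) (fun k => by positivity)
  have ht0 : 0 < t := by linarith
  have hgen' : ∀ (k k' m m' : ℕ), k ≠ k' → 1 ≤ m → 1 ≤ m' →
      Real.sqrt m * alphaEnc B t k ≠ Real.sqrt m' * alphaEnc B t k' := hgen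
  refine ⟨fun β => alphaEnc B t (stepIdx β), gammaEnc (alphaEnc B t), 1, 1, c / 4, |C|, one_pos,
    by positivity, fun β => alphaEnc_pos B ht0.le _, ?_,
    fun s _ _ => ⟨gammaEnc_pos _ s, gammaEnc_le_one _ s⟩, ?_⟩
  · -- `a → 0`: the ladder is unbounded
    refine Metric.tendsto_atTop.2 fun ε hε => ?_
    obtain ⟨L₀, hL₀⟩ := exists_nat_one_div_lt (half_pos hε)
    obtain ⟨K, hK⟩ := pow_unbounded_of_one_lt (env B L₀) (by norm_num : (1 : ℝ) < 2)
    refine ⟨(2 : ℝ) ^ K, fun β hβ => ?_⟩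
    have hk : K ≤ stepIdx β := le_stepIdx_of_le hβ
    have henv : env B L₀ ≤ (2 : ℝ) ^ stepIdx β :=
      hK.le.trans (pow_le_pow_right₀ (by norm_num) hk)
    have hL : L₀ ≤ ladder B (stepIdx β) := le_ladder B henv
    have hL' : (L₀ : ℝ) + 1 ≤ (ladder B (stepIdx β) : ℝ) + 1 := by
      exact_mod_cast Nat.succ_le_succ hL
    rw [Real.dist_eq, sub_zero, abs_of_pos (alphaEnc_pos B ht0.le _)]
    calc alphaEnc B t (stepIdx β) ≤ 2 / ((ladder B (stepIdx β) : ℝ) + 1) := alphaEnc_le B ht2 _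
      _ ≤ 2 / ((L₀ : ℝ) + 1) := div_le_div_of_nonneg_left (by norm_num) (by positivity) hL'
      _ = 2 * (1 / ((L₀ : ℝ) + 1)) := by ring
      _ < 2 * (ε / 2) := by gcongr
      _ = ε := by ring
  · -- the clauses on a femto torus in step `k`
    intro L _ β hβ hLa
    have hβ1 : 1 ≤ β := hβ
    have h2k : (2 : ℝ) ^ stepIdx β ≤ β := two_pow_stepIdx_le hβ1
    have hβlt : β < (2 : ℝ) ^ (stepIdx β + 1) := lt_two_pow_stepIdx_succ β
    have hL1 : 1 ≤ L := Nat.one_le_iff_ne_zero.2 (NeZero.ne L)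
    have hLa' : (L : ℝ) * alphaEnc B t (stepIdx β) ≤ 1 := hLa
    have hLk : L ≤ ladder B (stepIdx β) := le_ladder_of_femto B ht0 hLa'
    have hBL : B L ≤ β := threshold_le B hL1 hLk h2k
    have HH := H L β hBL
    obtain ⟨hax, hall⟩ := HH
    refine ⟨fun n hn h8 => ?_, fun x y i j i' j' hxy hij hij' => ?_⟩
    · obtain ⟨h_lo, h_hi⟩ := hax n hn h8
      have hΓ : gammaEnc (alphaEnc B t) ((n : ℝ) * alphaEnc B t (stepIdx β)) =
          ((4 : ℝ) ^ stepIdx β)⁻¹ := by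
        have e : (n : ℝ) * alphaEnc B t (stepIdx β) =
            Real.sqrt ((n ^ 2 : ℕ) : ℝ) * alphaEnc B t (stepIdx β) := by
          congr 1
          push_cast
          rw [Real.sqrt_sq (Nat.cast_nonneg n)]
        rw [e]
        exact gammaEnc_eq hgen' (stepIdx β) (n ^ 2) (by nlinarith)
      rw [hΓ]
      exact band_to_levels h2k hβlt hc h_lo h_hi
    · have hxy' := hall x y i j i' j' hxy hij hij'
      obtain ⟨m, hm, hdist⟩ := dist_eq_sqrt_nat x y hxy
      dsimp only at hxy' ⊢
      rw [hdist] at hxy' ⊢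
      have hΓ : gammaEnc (alphaEnc B t) (Real.sqrt (m : ℝ) * alphaEnc B t (stepIdx β)) =
          ((4 : ℝ) ^ stepIdx β)⁻¹ :=
        gammaEnc_eq hgen' (stepIdx β) m hm
      rw [hΓ]
      exact allpairs_to_levels h2k (by positivity) hxy'

/-! ## § Composition -/

/-- **Composition (kernel-checked; the ONLY theorem of this file concluding the crux by name).** The
three registered stubs imply the crux: K1, (K1 → K2⁻), (K1 → K2⁺) give C⁺
(`fixedTorusTwoSided_of`), and the proved generic-step encoding (`encoding_at`) gives
`LangevinControlUV.FemtoCurvatureTwoPoint`. -/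
theorem FemtoCurvatureTwoPoint_of :
    Sig.stub_kernelMargin → Sig.stub_axisLower → Sig.stub_pairUpper →
      Summit.QuantumFields.YangMills.Theses.LangevinControlUV.FemtoCurvatureTwoPoint := by
  intro hK hA hU G _ _ _ _ hG r
  letI : MeasurableSpace G := borel G
  haveI : BorelSpace G := ⟨rfl⟩
  obtain ⟨B, c, C, hc, H⟩ := fixedTorusTwoSided_of (hA hK) (hU hK) G hG r
  exact encoding_at r hc H

/-- **Transfer `C⁺ ⇒ crux` (the card's `crux_of_encoding`, PROVED)**, concluded in the unbundled
form `∀ G r, CruxAt r` so that `FemtoCurvatureTwoPoint_of` stays the file's unique crux-concluding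
theorem; `femtoCurvatureTwoPoint_iff_cruxAt.2 (encoding h)` is the crux itself. -/
theorem encoding (hC : FixedTorusTwoSided) :
    ∀ (G : Type) [Group G] [TopologicalSpace G] [IsTopologicalGroup G] [CompactSpace G],
      IsCompactSimpleLieGroup G →
        letI : MeasurableSpace G := borel G
        haveI : BorelSpace G := ⟨rfl⟩
        ∀ r : LatticeRep G, CruxAt r := by
  intro G _ _ _ _ hG r
  letI : MeasurableSpace G := borel G
  haveI : BorelSpace G := ⟨rfl⟩
  obtain ⟨B, c, C, hc, H⟩ := hC G hG r
  exact encoding_at r hc H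

/-! ## § Nesting with line `deep-band-gaussian-regime` (TRIAGE r1-3, sharpen (3))

`DeepBandTwoPoint` below is a VERBATIM copy of `Ideator2.DeepBandTwoPoint`
(`Cruxes/FemtoCurvatureTwoPoint/SketchIdeator2.lean`); it implies this line's C⁺ with thresholds
`B(L) := max β₀ (M log L)`, so the two encoding lines are two rungs (per-torus limit /
`L`-uniform band) over ONE transfer `encoding`. -/

/-- Verbatim copy of `Ideator2.DeepBandTwoPoint` (C⁺ of card `deep-band-gaussian-regime`). -/
def DeepBandTwoPoint : Prop :=
  ∀ (G : Type) [Group G] [TopologicalSpace G] [IsTopologicalGroup G] [CompactSpace G],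
    IsCompactSimpleLieGroup G →
    letI : MeasurableSpace G := borel G
    haveI : BorelSpace G := ⟨rfl⟩
    ∀ (r : LatticeRep G), ∃ (M β₀ c C : ℝ), 0 < M ∧ 0 < c ∧
      ∀ (L : ℕ) [NeZero L] (β : ℝ), β₀ ≤ β → Real.log (L : ℝ) ≤ β / M →
        let P : (Fin 4 → ZMod L) → Fin 4 → Fin 4 → GaugeConfig 4 L G → ℝ :=
          fun x i j U => (r.N : ℝ) - (r.ρ (plaquetteHolonomy U x i j)).trace.re
        let E : (GaugeConfig 4 L G → ℝ) → ℝ := fun F => wilsonExpectation (d := 4) (L := L) r.ρ β F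
        let cov : (GaugeConfig 4 L G → ℝ) → (GaugeConfig 4 L G → ℝ) → ℝ :=
          fun F F' => E (fun U => F U * F' U) - E F * E F'
        let dist : (Fin 4 → ZMod L) → (Fin 4 → ZMod L) → ℝ :=
          fun x y => Real.sqrt (∑ k : Fin 4, (((x k - y k).valMinAbs : ℤ) : ℝ) ^ 2)
        (∀ n : ℕ, 1 ≤ n → 8 * n ≤ L →
            c ≤ β ^ 2 * ((n : ℝ) ^ 8 * cov (P 0 0 1) (P (Pi.single (2 : Fin 4) ((n : ℕ) : ZMod L)) 0 1)) ∧
            β ^ 2 * ((n : ℝ) ^ 8 * cov (P 0 0 1) (P (Pi.single (2 : Fin 4) ((n : ℕ) : ZMod L)) 0 1)) ≤ C) ∧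
        (∀ (x y : Fin 4 → ZMod L) (i j i' j' : Fin 4), x ≠ y → i ≠ j → i' ≠ j' →
            β ^ 2 * (|cov (P x i j) (P y i' j')| * dist x y ^ 8) ≤ C)

/-- The deep band is a uniform threshold: `DeepBandTwoPoint ⇒ FixedTorusTwoSided` with
`B(L) = max β₀ (M · log L)`. -/
theorem fixedTorusTwoSided_of_deepBand : DeepBandTwoPoint → FixedTorusTwoSided := by
  intro hD G _ _ _ _ hG r
  obtain ⟨M, β₀, c, C, hM, hc, H⟩ := hD G hG r
  refine ⟨fun L => max β₀ (M * Real.log (L : ℝ)), c, C, hc, ?_⟩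
  intro L _ β hβ
  have hβ' : max β₀ (M * Real.log (L : ℝ)) ≤ β := hβ
  have h1 : β₀ ≤ β := (le_max_left _ _).trans hβ'
  have h2 : Real.log (L : ℝ) ≤ β / M := by
    rw [le_div_iff₀ hM, mul_comm]
    exact (le_max_right _ _).trans hβ'
  exact H L β h1 h2

/-- Hence the deep-band engine also closes the crux through THIS file's transfer (unbundled form;
`femtoCurvatureTwoPoint_iff_cruxAt.2 (cruxAt_of_deepBand h)` is the crux). -/
theorem cruxAt_of_deepBand (h : DeepBandTwoPoint) :
    ∀ (G : Type) [Group G] [TopologicalSpace G] [IsTopologicalGroup G] [CompactSpace G],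
      IsCompactSimpleLieGroup G →
        letI : MeasurableSpace G := borel G
        haveI : BorelSpace G := ⟨rfl⟩
        ∀ r : LatticeRep G, CruxAt r :=
  encoding (fixedTorusTwoSided_of_deepBand h)

end Summit.QuantumFields.YangMills.Cruxes.FemtoCurvatureTwoPoint.GenericStepGammaEncoding

end
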